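import Summits.BirchSwinnertonDyer.BirchSwinnertonDyer.Theorems.KolyvaginDepthDoorMSymbolCert389a1Twist
import HarnessLib

/-!
# Route `KolyvaginDepthDoor`, crux `KolyvaginDepthSupplyKN` (stmt-BirchSwinnertonDyer-22820) —
# DEPTH TABLE v27: ROW `389a1` @ `(5, −7)` WITH BOTH KURIHARA CLAIMS DISCHARGED — the clause of the crux at
# `389a1` CONDITIONAL ON PRINT ONLY (Kim Thm. 1.11, modularity, Mazur Cor. 4.1, W. Zhang L8.4 (1)/9.1 by name)

Helper file of the lead prover of line `levelone` (kdd-p1 g31; `--supports stmt-BirchSwinnertonDyer-22820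
--as helper`); it closes nothing and BSD is NOT proved by it.

v17's row `C389a1.cruxBody_of_kuriharaClaims_5_neg7` took TWO computed claims (PARI `msfromell` output):
`hδE` (the mod-5 Kurihara number of `389a1` at `41·61`) and `hδT` (that of `T₀ = 19061a1 = 389a1^{(−7)}` at
`211`). `…KuriharaRow389a1CertifiedE` proved `hδE` (the kernel-certified plus M-symbol of `389a1`). THIS FILE
proves `hδT` from modularity of `389a1` by name (`exists_isNewformOf`, already a hypothesis of the row): the
newform of `T₀` is the twist `f₀ ⊗ χ₋₇` (`…MSymbolCert389a1Twist`), its plus symbols are `C ·` twisted sums of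
the CERTIFIED minus symbols of `f₀` (`exists_const_T0`); `C` is a `5`-adic unit — `|C|₅ ≤ 1` by the tree's
integrality `norm_ratPlusSymbol_le_one` at the unit value `sigmaT 1 = 7`, `|C|₅ ≥ 1` because `re Λ = ℤ·Ω⁺/2`
forces `C k = 1/2` for an integer `k` —, and the Kurihara sum `∑_a sigmaT(a) log₂(a) ≡ 1 (mod 5)` is decided
by the kernel. Hence `C389a1.kuriharaClaimT_5_211` (= `hδT` verbatim, from `hnf`) and the row
`C389a1.cruxBody_of_print_5_neg7`: for every `K` with `d_K = −7`, the clause of `KolyvaginDepthSupplyKN` holds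
at `W = 389a1` VERBATIM, CONDITIONAL ON THE FOUR NAMED PRINT FACTS ONLY — no computational claim remains.
Per curve; nothing class-wide; (S♭) untouched; BSD is NOT proved by any of this.

References: [Kim2022StructureSelmer] Thm. 1.11, §1.4.3; [MazurTateTeitelbaum1986Invent] §I.8;
[CremonaAlgorithms1997] §2.8, Table 1 (389a1); [WZhang2014] Lemma 8.4 (1), Thm. 9.1; [Mazur1978] Cor. 4.1.
-/

set_option linter.dupNamespace false

noncomputable section

open scoped MatrixGroups ModularForm Classical NumberField
open CongruenceSubgroup
open Literature.NumberTheory.EllipticCurves Literature.NumberTheory.EllipticCurves.ModularForms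
open Summit.BirchSwinnertonDyer.BirchSwinnertonDyer.Rank2Observatory

namespace Summit.BirchSwinnertonDyer.BirchSwinnertonDyer.Theorems.KolyvaginDepthDoor.MSymbolCert.Cert389a1

/-! ## §1 A rational line through all plus symbols meets `1/2` -/

/-- **`[r]⁺_g ∈ C ℤ` for all `r` ⟹ `C k = 1/2` for some integer `k`** (`g` a normalised rational newform): every
period is `{∞, γ∞}_g`, with real part `Ω⁺_g · [γ∞]⁺_g ∈ Ω⁺_g C ℤ`, while `re Λ_g = ℤ · Ω⁺_g/2` (`plusPeriod`).
[cite: CremonaAlgorithms1997, §2.8] -/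
theorem exists_mul_eq_half {L : ℕ} [NeZero L] (g : CuspForm (Gamma0 L) 2) (hg : IsNewform0 g)
    (hQ : coeffField g = ⊥) {C : ℚ} (hC : ∀ r : ℚ, ∃ m : ℤ, ratPlusSymbol g r = C * m) :
    ∃ k : ℤ, C * k = 1 / 2 := by
  have hΩ : 0 < plusPeriod g := IsNewform0.plusPeriod_pos_holds hg hQ
  have hre : realPeriods g = AddSubgroup.zmultiples (plusPeriod g / 2) :=
    realPeriods_eq_zmultiples_of_plusPeriod_pos g hΩ
  have hreal : ∀ m, (cuspCoeff g m).im = 0 := cuspCoeff_im_eq_zero_of_coeffField_eq_bot hQ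
  -- `re {∞, r}_g = Ω⁺ · [r]⁺_g`
  have hsym : ∀ r : ℚ, (modularSymbol g r).re = plusPeriod g * ratPlusSymbol g r := by
    intro r
    have h1 : (ratPlusSymbol g r : ℝ) = (plusSymbol g r).re / plusPeriod g := by
      rw [ratCast_ratPlusSymbol_holds hg hQ, normalizedPlusSymbol]
    have h2 : (plusSymbol g r).re = (modularSymbol g r).re := by
      rw [plusSymbol_eq_re_of g (modularSymbol_neg_eq_conj_holds g) hreal r]; simp
    rw [h2] at h1
    rw [h1]; field_simp
  have hlat : ∀ x ∈ periodLattice g, ∃ m : ℤ, x.re = plusPeriod g * C * m := by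
    intro x hx
    induction hx using AddSubgroup.closure_induction with
    | mem x hx =>
      obtain ⟨γ, rfl⟩ := hx
      unfold cuspSymbol
      split_ifs with h0
      · exact ⟨0, by simp⟩
      · obtain ⟨m, hm⟩ := hC ((((γ : SL(2, ℤ)) 0 0 : ℤ) : ℚ) / (((γ : SL(2, ℤ)) 1 0 : ℤ) : ℚ))
        refine ⟨m, ?_⟩
        rw [hsym, hm]; push_cast; ring
    | zero => exact ⟨0, by simp⟩
    | add x y _ _ hx hy =>
      obtain ⟨a, ha⟩ := hx; obtain ⟨b, hb⟩ := hy
      exact ⟨a + b, by rw [Complex.add_re, ha, hb]; push_cast; ring⟩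
    | neg x _ hx =>
      obtain ⟨a, ha⟩ := hx
      exact ⟨-a, by rw [Complex.neg_re, ha]; push_cast; ring⟩
  have hmem : plusPeriod g / 2 ∈ realPeriods g := by rw [hre]; exact AddSubgroup.mem_zmultiples _
  rw [realPeriods, AddSubgroup.mem_map] at hmem
  obtain ⟨x, hx, hxre⟩ := hmem
  obtain ⟨k, hk⟩ := hlat x hx
  have hxre' : x.re = plusPeriod g / 2 := hxre
  refine ⟨k, ?_⟩
  have h : (plusPeriod g : ℝ) * ((C : ℝ) * k) = plusPeriod g * (1 / 2) := by
    rw [← mul_assoc, ← hk, hxre']; ring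
  have h' := mul_left_cancel₀ hΩ.ne' h
  have hcast : ((C * k : ℚ) : ℝ) = ((1 / 2 : ℚ) : ℝ) := by push_cast; linarith
  exact Rat.cast_injective hcast

/-- **The Kurihara number on a rational line with unit slope.** If `[k/n]⁺_g = C · S(k)` for all `k` prime to `n`
with `p ∤ C.num`, `p ∤ C.den` (`p` odd), then `kuriharaNumber g p n ψ ≠ 0` as soon as the kernel's `kSum ≠ 0` —
kit 4's `kuriharaNumber_eq_unit_mul_kSum` with `ε = 2 C.num`, `g = C.den`. [cite: Kim2022StructureSelmer, §1.4.3] -/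
theorem kuriharaNumber_ne_zero_of_const {L : ℕ} (g : CuspForm (Gamma0 L) 2) (p n : ℕ) [Fact p.Prime] [NeZero n]
    (hp2 : p ≠ 2) (T : ℕ → List ℕ) (hT : ∀ ℓ, T ℓ = [] ∨ (ℓ.Prime ∧ tabOK ℓ p (T ℓ) = true)) (S : ℕ → ℤ) (C : ℚ)
    (hnum : ¬ (p : ℤ) ∣ C.num) (hden : ¬ p ∣ C.den)
    (hsym : ∀ k < n, Nat.Coprime k n → ratPlusSymbol g ((k : ℚ) / n) = C * S k)
    (hK : kSum p n S n.primeFactors T ≠ 0) :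
    kuriharaNumber g p n (tabFamily p T hT) ≠ 0 := by
  have hpP : p.Prime := Fact.out
  have h2v : ¬ p ∣ 2 * C.den := by
    intro h
    rcases (Nat.Prime.dvd_mul hpP).mp h with h2 | h2
    · exact hp2 ((Nat.prime_dvd_prime_iff_eq hpP Nat.prime_two).mp h2)
    · exact hden h2
  have hsym' : ∀ k < n, Nat.Coprime k n →
      ratPlusSymbol g ((k : ℚ) / n) = (2 * C.num : ℤ) * S k / (2 * C.den) := by
    intro k hk hkc
    rw [hsym k hk hkc]
    have hd : (C.den : ℚ) ≠ 0 := by exact_mod_cast C.den_ne_zero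
    nth_rewrite 1 [← Rat.num_div_den C]
    push_cast
    field_simp
  rw [kuriharaNumber_eq_unit_mul_kSum g p n T hT S (2 * C.num) C.den h2v hsym']
  refine mul_ne_zero (div_ne_zero ?_ ?_) hK
  · push_cast
    refine mul_ne_zero ?_ ?_
    · rw [ne_eq, show (2 : ZMod p) = ((2 : ℕ) : ZMod p) by norm_num, ZMod.natCast_eq_zero_iff]
      intro h; exact hp2 ((Nat.prime_dvd_prime_iff_eq hpP Nat.prime_two).mp h)
    · rw [ne_eq, ZMod.intCast_zmod_eq_zero_iff_dvd]; exact hnum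
  · rw [ne_eq, ZMod.natCast_eq_zero_iff]; exact h2v

/-! ## §2 The Kurihara data of `T₀` at `(5, 211)` -/

/-- Discrete-log table modulo `211`, base `2` (the root of the record `cert_19061a1`). [folklore] -/
def tab211 : List ℕ := [0, 0, 1, 43, 2, 132, 44, 139, 3, 86, 133, 162, 45, 144, 140, 175, 4, 199, 87, 154, 134, 182, 163, 21, 46, 54, 145, 129, 141, 179, 176, 115, 5, 205, 200, 61, 88, 118, 155, 187, 135, 17, 183, 80, 164, 8, 22, 124, 47, 68, 55, 32, 146, 208, 130, 84, 142, 197, 180, 52, 177, 203, 116, 15, 6, 66, 206, 195, 201, 64, 62, 168, 89, 170, 119, 97, 156, 91, 188, 102, 136, 172, 18, 112, 184, 121, 81, 12, 165, 99, 9, 73, 23, 158, 125, 76, 48, 93, 69, 38, 56, 190, 33, 26, 147, 104, 209, 42, 131, 138, 85, 161, 143, 174, 198, 153, 181, 20, 53, 128, 178, 114, 204, 60, 117, 186, 16, 79, 7, 123, 67, 31, 207, 83, 196, 51, 202, 14, 65, 194, 63, 167, 169, 96, 90, 101, 171, 111, 120, 11, 98, 72, 157, 75, 92, 37, 189, 25,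 103, 41, 137, 160, 173, 152, 19, 127, 113, 59, 185, 78, 122, 30, 82, 50, 13, 193, 166, 95, 100, 110, 10, 71, 74, 36, 24, 40, 159, 151, 126, 58, 77, 29, 49, 192, 94, 109, 70, 35, 39, 150, 57, 28, 191, 108, 34, 149, 27, 107, 148, 106, 105]

/-- Multiplicativity of the table (decide). [folklore] -/
theorem tabOK_211 : tabOK 211 5 tab211 = true := by
  decide +kernel

/-- Surjectivity of the table onto `ℤ/5` (decide). [folklore] -/
theorem tabSurj_211 : tabSurj 211 5 tab211 = true := by
  decide +kernel

/-- The table family for `n = 211`. [folklore] -/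
def T211 (ℓ : ℕ) : List ℕ := if ℓ = 211 then tab211 else []

/-- Admissibility of the table family. [folklore] -/
theorem T211_ok : ∀ ℓ, T211 ℓ = [] ∨ (ℓ.Prime ∧ tabOK ℓ 5 (T211 ℓ) = true) := by
  intro ℓ
  by_cases h : ℓ = 211
  · right
    rw [h, T211, if_pos rfl]
    exact ⟨by norm_num, tabOK_211⟩
  · left; simp [T211, h]

/-- `211` is prime: `(211).primeFactors = {211}`. [folklore] -/
theorem primeFactors_211 : (211 : ℕ).primeFactors = {211} := Nat.Prime.primeFactors (by norm_num)

/-- Surjectivity at the prime factors of `211`. [folklore] -/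
theorem T211_surj : ∀ ℓ ∈ (211 : ℕ).primeFactors, tabSurj ℓ 5 (T211 ℓ) = true := by
  rw [primeFactors_211]
  intro ℓ hℓ
  rw [Finset.mem_singleton] at hℓ
  rw [hℓ, T211, if_pos rfl]
  exact tabSurj_211

/-- The unit witness `sigmaT 1 = 7` (decide). [folklore] -/
theorem sigmaT_one : sigmaT 1 = 7 := by
  decide +kernel

/-- **The twisted Kurihara sum is `≢ 0 (mod 5)`** (decide: `∑_{0<a<211} sigmaT(a) · log₂(a mod 211) ≡ 1`).
[cite: Kim2022StructureSelmer, §1.4.3] -/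
theorem kSumT_ne_zero : kSum 5 211 sigmaT (211 : ℕ).primeFactors T211 ≠ 0 := by
  rw [primeFactors_211, kSum, ← list_range_map_sum]
  decide +kernel

/-! ## §3 The Kurihara number of the newform of `T₀` -/

/-- **`δ̃_{211}(19061a1) ≢ 0 (mod 5)` from modularity of `389a1` by name.** For every modular parametrisation datum
`D` of `T₀` at a level equal to `19061`: the table logarithm `ψ` (root `2`) is surjective and
`kuriharaNumber D.f 5 211 ψ ≠ 0`. [cite: Kim2022StructureSelmer, §1.4.3] [cite: MazurTateTeitelbaum1986Invent, §I.8] -/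
theorem exists_kuriharaNumber_ne_zero_T0 (hnf : exists_isNewformOf) (N : ℕ) (hN : N = 19061) [NeZero N]
    (D : haveI := C389a1.minTwist7_isElliptic; ModularParametrizationData T0 N) :
    ∃ ψ : (ℓ : ℕ) → (ZMod ℓ)ˣ →* Multiplicative (ZMod 5),
      (∀ ℓ ∈ (211 : ℕ).primeFactors, Function.Surjective (ψ ℓ)) ∧ kuriharaNumber D.f 5 211 ψ ≠ 0 := by
  subst hN
  haveI := C389a1.minTwist7_isElliptic
  haveI := C389a1.minTwist7_isGloballyMinimal
  haveI : Fact (Nat.Prime 5) := ⟨by norm_num⟩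
  haveI : NeZero (211 : ℕ) := ⟨by norm_num⟩
  have hg := D.isNewformOf
  obtain ⟨C, hCall, hCval⟩ := exists_const_T0 hnf D.f hg
  -- `|C|₅ ≥ 1`: `C k = 1/2`
  obtain ⟨k, hk⟩ := exists_mul_eq_half D.f hg.1 hg.coeffField_eq_bot hCall
  -- `|C|₅ ≤ 1`: integrality at `1/211`, `sigmaT 1 = 7`
  have hirr : T0.HasIrreducibleModPGaloisRep 5 :=
    hasIrreducibleModPGaloisRep_of_hasSurjectiveModNGaloisRep _ 5 C389a1.minTwist7_hasSurjectiveModNGaloisRep_5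
  have hle : ‖((ratPlusSymbol D.f (((1 : ℕ) : ℚ) / 211) : ℚ) : ℚ_[5])‖ ≤ 1 := by
    refine IsNewformOf.norm_ratPlusSymbol_le_one hg (by norm_num) hirr ?_
    have hden : (((1 : ℕ) : ℚ) / 211).den = 211 := by norm_num
    rw [hden]; norm_num
  rw [hCval 1 (by norm_num) (by norm_num), sigmaT_one] at hle
  -- hence `|C|₅ = 1`
  have h7 : ‖(7 : ℚ_[5])‖ = 1 := by
    have := (Padic.norm_natCast_eq_one_iff (p := 5) (n := 7)).mpr (by norm_num)
    simpa using this
  have h2 : ‖(2 : ℚ_[5])‖ = 1 := by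
    have := (Padic.norm_natCast_eq_one_iff (p := 5) (n := 2)).mpr (by norm_num)
    simpa using this
  have hle' : ‖(C : ℚ_[5])‖ ≤ 1 := by
    have e : ((C * ((7 : ℤ) : ℚ) : ℚ) : ℚ_[5]) = (C : ℚ_[5]) * 7 := by push_cast; ring
    rw [e, norm_mul, h7, mul_one] at hle
    exact hle
  have hk1 : ‖((k : ℤ) : ℚ_[5])‖ ≤ 1 := Padic.norm_int_le_one k
  have hprod : ‖(C : ℚ_[5])‖ * ‖((k : ℤ) : ℚ_[5])‖ = 1 := by
    have e : ((C * k : ℚ) : ℚ_[5]) = (C : ℚ_[5]) * ((k : ℤ) : ℚ_[5]) := by push_cast; ring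
    rw [← norm_mul, ← e, hk]
    push_cast
    rw [norm_div, norm_one, h2]; norm_num
  have hC5 : ‖(C : ℚ_[5])‖ = 1 := by
    apply le_antisymm hle'
    nlinarith [norm_nonneg (C : ℚ_[5]), norm_nonneg ((k : ℤ) : ℚ_[5])]
  -- so numerator and denominator of `C` are prime to `5`
  have hCq : (C : ℚ_[5]) = ((C.num : ℤ) : ℚ_[5]) / ((C.den : ℕ) : ℚ_[5]) := by
    rw [← Rat.cast_intCast, ← Rat.cast_natCast, ← Rat.cast_div, Rat.num_div_den]
  have hnum1 : ‖((C.num : ℤ) : ℚ_[5])‖ ≤ 1 := Padic.norm_int_le_one _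
  have hden1' : ‖((C.den : ℕ) : ℚ_[5])‖ ≤ 1 := by
    have := Padic.norm_int_le_one (p := 5) (C.den : ℤ)
    simpa using this
  have hdpos : 0 < ‖((C.den : ℕ) : ℚ_[5])‖ := norm_pos_iff.mpr (by exact_mod_cast C.den_ne_zero)
  have hC5' : ‖((C.num : ℤ) : ℚ_[5])‖ = ‖((C.den : ℕ) : ℚ_[5])‖ := by
    rw [hCq, norm_div, div_eq_one_iff_eq hdpos.ne'] at hC5
    exact hC5
  have hden : ¬ 5 ∣ C.den := fun h => by
    have hlt : ‖((C.den : ℕ) : ℚ_[5])‖ < 1 := Padic.norm_natCast_lt_one_iff.mpr h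
    have hnumlt : ‖((C.num : ℤ) : ℚ_[5])‖ < 1 := by rw [hC5']; exact hlt
    have h5num : (5 : ℤ) ∣ C.num := Padic.norm_intCast_lt_one_iff.mp hnumlt
    have hg5 : (5 : ℕ) ∣ Nat.gcd C.num.natAbs C.den := Nat.dvd_gcd (Int.natAbs_dvd_natAbs.mpr h5num) h
    rw [C.reduced] at hg5
    omega
  have hnum : ¬ (5 : ℤ) ∣ C.num := fun h => by
    have hlt : ‖((C.num : ℤ) : ℚ_[5])‖ < 1 := Padic.norm_intCast_lt_one_iff.mpr h
    have hden1 : ‖((C.den : ℕ) : ℚ_[5])‖ = 1 :=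
      Padic.norm_natCast_eq_one_iff.mpr ((Nat.Prime.coprime_iff_not_dvd (by norm_num)).mpr hden)
    rw [hden1] at hC5'
    linarith
  refine ⟨tabFamily 5 T211 T211_ok, fun ℓ hℓ =>
    surjective_tabFamily 5 T211 T211_ok (Nat.prime_of_mem_primeFactors hℓ) (T211_surj ℓ hℓ), ?_⟩
  exact kuriharaNumber_ne_zero_of_const D.f 5 211 (by norm_num) T211 T211_ok sigmaT C hnum hden
    (fun a ha hac => hCval a ha hac) kSumT_ne_zero

end Summit.BirchSwinnertonDyer.BirchSwinnertonDyer.Theorems.KolyvaginDepthDoor.MSymbolCert.Cert389a1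

/-! ## §4 The row: both claims discharged -/

namespace Summit.BirchSwinnertonDyer.BirchSwinnertonDyer.Theorems.KolyvaginDepthDoor

open WeierstrassCurve NumberField IsDedekindDomain
open Summit.BirchSwinnertonDyer.BirchSwinnertonDyer.Theorems

namespace C389a1

/-- **THE TWIST-SIDE KURIHARA CLAIM OF ROW `389a1` @ `(5, −7)` FROM MODULARITY BY NAME.** Literally the hypothesis
`hδT` of `cruxBody_of_kuriharaClaims_5_neg7` (the claim of the tree record `cert_19061a1` @ `(5, 211)`), proved from
`exists_isNewformOf` (`MSymbolCert.Cert389a1.exists_kuriharaNumber_ne_zero_T0`, `N(T₀) = 19061`).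
[cite: Kim2022StructureSelmer, §1.4.3] [cite: MazurTateTeitelbaum1986Invent, §I.8] -/
theorem kuriharaClaimT_5_211 (hnf : exists_isNewformOf) :
    haveI := minTwist7_isElliptic; haveI := minTwist7_isGloballyMinimal;
      haveI : NeZero (((⟨0, -1, 1, -114, -302⟩ : WeierstrassCurve ℤ).map (Int.castRingHom ℚ)).conductorNorm ℤ) :=
        neZero_conductorNorm_of_isElliptic _;
      haveI := Fact.mk (by norm_num : Nat.Prime 5);
      ∀ (D : ModularParametrizationData ((⟨0, -1, 1, -114, -302⟩ : WeierstrassCurve ℤ).map (Int.castRingHom ℚ))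
          (((⟨0, -1, 1, -114, -302⟩ : WeierstrassCurve ℤ).map (Int.castRingHom ℚ)).conductorNorm ℤ)),
        ¬ ((5 : ℕ) : ℤ) ∣ D.maninConstant →
        (∃ u : ℚ, ‖(u : ℚ_[5])‖ = 1 ∧
          ((⟨0, -1, 1, -114, -302⟩ : WeierstrassCurve ℤ).map (Int.castRingHom ℚ)).realPeriodRat = u * plusPeriod D.f) →
        ∃ ψ : (ℓ : ℕ) → (ZMod ℓ)ˣ →* Multiplicative (ZMod 5),
          (∀ ℓ ∈ (211 : ℕ).primeFactors, Function.Surjective (ψ ℓ)) ∧ kuriharaNumber D.f 5 211 ψ ≠ 0 := by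
  intro D _ _
  haveI := minTwist7_isElliptic
  haveI : NeZero (((⟨0, -1, 1, -114, -302⟩ : WeierstrassCurve ℤ).map (Int.castRingHom ℚ)).conductorNorm ℤ) :=
    neZero_conductorNorm_of_isElliptic _
  exact MSymbolCert.Cert389a1.exists_kuriharaNumber_ne_zero_T0 hnf _ MSymbolCert.Cert389a1.conductorNorm_T0 D

/-- **DEPTH-TABLE ROW `389a1`, `(p, d_K) = (5, −7)`, v27 — NO COMPUTATIONAL CLAIM LEFT.** For every imaginary quadratic
`K` with `d_K = −7`: granted Kim 2026 Thm. 1.11 (`hKim`), modularity (`hnf`), Mazur 1978 Cor. 4.1 (`hMaz`) and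
W. Zhang 2014 L8.4 (1)/9.1 (`h84`) BY NAME, the clause of the crux `KolyvaginDepthSupplyKN` holds at `W = 389a1` VERBATIM
— v17's `cruxBody_of_kuriharaClaims_5_neg7` with BOTH Kurihara claims PROVED (`kuriharaClaim_5_2501` by the kernel-certified
plus M-symbol of `389a1`; `kuriharaClaimT_5_211` by the certified minus M-symbol and the twist formula, from `hnf`).
CONDITIONAL on the four named print facts ONLY; per curve; nothing class-wide; BSD is not proved by it.
[cite: Kim2022StructureSelmer, Thm. 1.11 (PDF p. 8)] [cite: WZhang2014, Lemma 8.4 (1) (p. 236), Thm. 9.1 (p. 240)]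
[cite: Mazur1978, Cor. 4.1] [cite: CremonaAlgorithms1997, Table 1 (389a1)] -/
theorem cruxBody_of_print_5_neg7
    (hKim : Kim2022_card_selmerGroup_le_pow_of_kuriharaNumber_ne_zero)
    (hnf : exists_isNewformOf) (hMaz : mazur_not_dvd_maninConstant_of_odd)
    (h84 : Literature.NumberTheory.EllipticCurves.WZhang2014_lemma84_exists_minimal_kolyvaginClass_one_selmerCard)
    (K : Type) [Field K] [NumberField K] (hK : IsImaginaryQuadratic K) (hD : NumberField.discr K = -7) :
    haveI := curve389a1_isGloballyMinimal;
    ∃ (p : ℕ) (hp : Fact p.Prime), 5 ≤ p ∧ Curve389a1.E.HasGoodReductionAtPrime p ∧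
      ¬ (p : ℤ) ∣ Curve389a1.E.frobeniusTrace p ∧ (∀ n : ℕ, Curve389a1.E.HasSurjectiveModNGaloisRep (p ^ n : ℕ)) ∧
      (∀ v : HeightOneSpectrum (𝓞 ℚ), Curve389a1.E.HasMultiplicativeReductionAt v →
        ¬ p ∣ Curve389a1.E.ordMinimalDiscriminant v) ∧
      ∃ (K : Type) (_ : Field K) (_ : NumberField K), IsImaginaryQuadratic K ∧
        NumberField.discr K ≠ -3 ∧ NumberField.discr K ≠ -4 ∧
        ∃ (_ : NeZero (Curve389a1.E.conductorNorm ℤ)), SatisfiesHeegnerHypothesis (Curve389a1.E.conductorNorm ℤ) K ∧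
        ∃ (Dt : ModularParametrizationData Curve389a1.E (Curve389a1.E.conductorNorm ℤ)) (β : ℤ) (ι : K →+* ℂ) (n₁ : ℕ)
          (d : KolyvaginHeegnerData Dt β ι n₁), Squarefree n₁ ∧
          (∀ q ∈ n₁.primeFactors, Zhang2014.IsKolyvaginPrime (Curve389a1.E.conductorNorm ℤ) Curve389a1.E K p q) ∧
          d.kolyvaginClass hp.out 1 ≠ 0 ∧
          (n₁.primeFactors.card + 1 ≤ Curve389a1.E.mordellWeilRank ∨
            (n₁.primeFactors.card ≤ Curve389a1.E.mordellWeilRank ∧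
              n₁.primeFactors.card + 1 ≤ (Curve389a1.E.quadraticTwist (NumberField.discr K : ℚ)).mordellWeilRank)) :=
  cruxBody_of_kuriharaClaimT_5_neg7 hKim hnf hMaz h84 K hK hD (kuriharaClaimT_5_211 hnf)

end C389a1

end Summit.BirchSwinnertonDyer.BirchSwinnertonDyer.Theorems.KolyvaginDepthDoor

end
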